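import Summits.ResolutionOfSingularities.ResolutionOfSingularities.Theses.SectionAscent
import Summits.ResolutionOfSingularities.ResolutionOfSingularities.Theorems.SectionAscentAffineToGlobalModificationPatching
import Summits.ResolutionOfSingularities.ResolutionOfSingularities.Theorems.SectionAscentAffineToGlobalAffineSingularLocus
import Summits.ResolutionOfSingularities.ResolutionOfSingularities.Theorems.SectionAscentAffineToGlobalRegularBlowupSuffices
import Summits.ResolutionOfSingularities.ResolutionOfSingularities.Theorems.SectionAscentAffineToGlobalIsolatedSingularitiesSuffice
import Literature.AlgebraicGeometry.Resolution.Temkin2008Localization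
import HarnessLib

/-!
# Crux `AffineToGlobal` (stmt-ResolutionOfSingularities-15961) — line `birth`, lead's skeleton (reshape 3)

Reshape 3 (lead gen 2) = reshape 2 of lead gen 1 (the Temkin cut, UNCHANGED: `stub_finiteSingularLocus`
LANDED, `stub_infiniteSingularLocus` OPEN) PLUS a second, independent cut in the WEAK frame (see the
section "Reshape 3" below and `## The weak-frame cut` in the file): the crux's conclusion
`ResolutionInChar p` only asks for `Scheme.HasResolution` — a proper birational morphism from a
regular scheme, NO isomorphism over `Reg`, NO `Sing`-supported centre — so globally it suffices
that SOME blow-up of each integral closed `X ⊆ ℙⁿ_K` along a non-zero ideal sheaf is regular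
(`stub_regularBlowupSuffices`, TRUE), and under the crux's hypothesis that is the case as soon as
some blow-up of `X` has only FINITELY many non-regular points (`stub_isolatedSingularitiesSuffice`,
TRUE: graded prime avoidance in `ℙⁿ_K` and on the blow-up puts them in one affine open, then the
landed one-shot-sheaf lemma and composition of blow-ups); the open residue of that cut is
`stub_isolatingBlowup` ("affine one-shots ⇒ every integral closed `X ⊆ ℙⁿ_K` has a blow-up with
isolated singularities"). Either open stub closes the crux (`AffineToGlobal_of_infiniteSingularLocus`,
`AffineToGlobal_of_isolatingBlowup`, both kernel-checked).

Route `ResolutionOfSingularities/SectionAscent`, crux #4 (rank 4):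
`AffineToGlobal` = "for every prime `p`: if the affine one-shot statement S⁺(p, d) holds for
every `d` (every integral affine variety `Spec A` of finite type over a field of characteristic
`p` admits an ideal `I ≠ 0` with `V(I) = Sing(Spec A)` exactly and `Bl_I(Spec A)` regular), then
`ResolutionInChar p`".

## History of the cut

* Birth (planner): `stub_affineToModification` (affine one-shots ⇒ one-shots on modifications of
  affine varieties, OPEN) + `stub_modificationPatching` (TRUE).
* Reshape 1 (lead gen 0): `stub_modificationPatching` PROVED and LANDED (p150313,
  `Theorems/SectionAscentAffineToGlobalModificationPatching.lean`, with p147829 `LocalModel`,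
  p148839 `IdealExtension`); in particular the weakest hypothesis the in-tree Temkin patching
  consumes is recorded there as `resolutionInChar_of_localDesingularization`: it suffices that
  for every integral `X` of finite type over a field `K` of characteristic `p`, every SINGULAR
  point `x` and every blow-up `g : S' → Spec 𝒪_{X,x}` whose non-regular points lie over the closed
  point, `S'` admits a desingularization (Temkin 2008, Prop. 2.3.4 (iii)). The one open stub
  `stub_affineToModification` was handed back (promote-stub).

## Reshape 2 (this file, lead gen 1)

The open stub is cut along the dichotomy "finitely / infinitely many non-regular points of `S'`"
and weakened to exactly Temkin's local condition:

* `stub_finiteSingularLocus` (TRUE, LANDED by this lead, p154487,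
  `Theorems.AffineToGlobal.AffineSingularLocus.stub_finiteSingularLocus`,
  `Theorems/SectionAscentAffineToGlobalAffineSingularLocus.lean`): if `S'` has finitely many
  non-regular points, it admits a desingularization — the finitely many points, seen in the
  spread-out blow-up `W → Spec A` of an affine chart, lie in one affine open `Ω` (graded prime
  avoidance on `Proj` of the Rees algebra); after shrinking the chart to a basic open around the
  image of the closed point, `Sing ⊆ Ω`, and the affine one-shot of `Ω` glues with the unit ideal
  to a `Sing`-exact one-shot ideal sheaf (`exists_oneShotSheaf_of_compl_regularLocus_subset`),
  which descends to `S'` along the flat pro-open immersion `S' → W`.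
* `stub_infiniteSingularLocus` (OPEN — the crux's honest residue): the same conclusion when `S'`
  has INFINITELY many non-regular points (all in the closed fibre, a projective `κ(x)`-scheme of
  dimension `≤ dim 𝒪_{X,x} - 1`, so this starts at `dim 𝒪_{X,x} = 2`, and at `3` for normal `S'`),
  GIVEN the full local statement at every point of strictly smaller local dimension of every
  integral variety over every field of characteristic `p` (induction hypothesis, supplied by the
  composition below by well-founded induction on `dim 𝒪_{X,x} ∈ WithBot ℕ∞`). Why the IH is the
  right currency: Temkin's localisation over the LOCAL base `Spec 𝒪_{X,x}`
  (`Theorems.Picover.LocalBlowups.admitsDesingularization_of_localBlowups`, any Noetherian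
  quasi-excellent base) reduces the stub to Temkin's condition at the points `s ∈ Sing S'` of the
  closed fibre for blow-ups of `Spec 𝒪_{S',s}`; `𝒪_{S',s}` is a local ring of the variety `W` with
  `dim 𝒪_{S',s} ≤ dim 𝒪_{X,x}`, EQUALITY iff `s` is closed in the fibre. So the IH discharges every
  non-closed point of the fibre, and what is genuinely open is the equal-dimension CLOSED-POINT
  TOWER `x ← s ← s' ← …` (each a closed point of the fibre over the previous one, positive-
  dimensional singular loci in every fibre): bare existence of non-canonical affine one-shots
  gives no termination measure for it (lead's `KERNEL.md`, attached to the item).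

Composition (kernel-checked, no `sorry` in its own term):
`AffineToGlobal_of_infiniteSingularLocus : Sig.stub_infiniteSingularLocus → AffineToGlobal` (and
`resolutionInChar_of_kernel` with both pieces as hypotheses) — Temkin's local condition by
well-founded induction on the local dimension (`localCondition_of_kernel`), then the LANDED
`ModificationPatching.resolutionInChar_of_localDesingularization` (Temkin/Picover patching +
`stub_projectiveIntegralSuffices`).

Both stub signatures are SELF-CONTAINED (Mathlib/Literature vocabulary only).

## Reshape 3 (this file, lead gen 2): the weak-frame cut, registered BESIDE the Temkin cut

Observation not used by gen 0/1: `Literature.AlgebraicGeometry.Resolution.Scheme.HasResolution X`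
(the conclusion of `ResolutionInChar`) is the WEAK existence statement — `∃ π : X' → X` proper,
birational, `X'` regular (Kollár 2007, Thm. 3.36, weak form) — whereas the Temkin patching the
line inherited works with `Scheme.AdmitsDesingularization` (a `Sing`-supported blow-up with regular
source), a strictly stronger currency (Cossart–Piltant 2019, p. 3: not known to follow from
resolution even for affine threefolds). In the weak frame the crux reads: "affine `Sing`-exact
one-shots in all dimensions ⇒ every integral closed `X ⊆ ℙⁿ_K` has SOME blow-up along a non-zero
ideal sheaf with regular source" (a blow-up of a locally Noetherian integral scheme along a
non-zero ideal is proper and birational, `IsBlowup.isResolution'`; the projective integral case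
suffices, `stub_projectiveIntegralSuffices`). Three stubs:

* `stub_regularBlowupSuffices` (TRUE, S — LANDED p157245 by this lead's wave): regular blow-ups of the integral closed subschemes of
  the `ℙⁿ_K` give `ResolutionInChar p` (hypothesis-free).
* `stub_isolatedSingularitiesSuffice` (TRUE, M — LANDED p157563 by this lead's wave): under `AffineOneShot p`, if some blow-up
  `X₁ → X` of the integral closed `X ⊆ ℙⁿ_K` along `J₁ ≠ 0` has FINITELY many non-regular points,
  then some blow-up of `X` along a non-zero ideal sheaf is regular — the finitely many points map
  into one basic affine open `X ∩ D₊(F)` of `X` (graded prime avoidance in `K[x₀,…,xₙ]`,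
  `GradedPrimeAvoidance.exists_form_basicOpen`), over which `X₁` is a blow-up of an affine scheme
  (`IsBlowup.restrict`), so they lie in one affine open of `X₁`
  (`exists_isAffineOpen_forall_mem_of_isBlowup`); the landed
  `AffineSingularLocus.exists_oneShotSheaf_of_compl_regularLocus_subset` gives a one-shot ideal
  sheaf on `X₁`, its blow-up is regular, and the composite with `X₁ → X` is a blow-up of `X` along a
  non-zero ideal sheaf (`IsBlowup.exists_isBlowup_comp`, Stacks 080B).
* `stub_isolatingBlowup` (OPEN — the weak-frame residue): under `AffineOneShot p`, every integral
  closed `X ⊆ ℙⁿ_K` (`char K = p`) has a blow-up along a non-zero ideal sheaf whose source has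
  finitely many non-regular points ("the singularities can be made isolated by one blow-up").
  Status in dimension `≤ 3`: the weak summit holds over every field (Cossart–Piltant 2019,
  Thm. 1.1), with `π` projective over each member of a specified finite AFFINE cover only; a
  regular PROJECTIVE model (= a regular blow-up, Liu 8.1.24), which this stub yields downstream,
  is Cossart–Piltant 2008/09 over fields differentially finite over a perfect field (Zariski–
  Piltant patching) — so even in dimension 3 over an arbitrary field the stub is at the edge of
  the literature; NOT implied by the weak summit (a proper regular model is dominated by a
  projective one only via Chow + re-resolving); open from dimension 4 like the summit.

Composition `AffineToGlobal_of_isolatingBlowup` (kernel-checked): isolating blow-up, then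
`stub_isolatedSingularitiesSuffice`, then `stub_regularBlowupSuffices`. The two cuts are
independent: EITHER open stub closes the crux. Why both residues are honest and what a line would
need beyond them: `Cruxes/AffineToGlobal/KERNEL.md` (gen 1) and `KERNEL-2.md` (gen 2: in the weak
frame normalization is an admissible local move, so local dimension 2 falls on paper and the first
hard case is a NORMAL 3-dimensional local blow-up with a singular curve in its closed fibre over
an arbitrary field; criterion: a resolution of a normal `S'` that is an isomorphism over `Reg` is a
`Sing`-supported blow-up iff it carries a relatively ample exceptional Cartier divisor; cones over
`W` have no finite multisections, so every cone/torsor transfer recovers affine opens only).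

Disproof used: `Cruxes/AffineToGlobal/Disproof.lean` (cdisprove cycle 1, rc 0): no
`_false_without_` lemma can exist (the crux is implied by the summit, `affineToGlobal_of_summit`);
its TRUE SUB-CASE remark is `stub_finiteSingularLocus`; its dead-end list (chartwise gluing, cone /
Jouanolou torsor without section, `K(t)`-spreading) is not retried here.
-/

noncomputable section

-- single-problem summit: the doubled namespace component `ResolutionOfSingularities` is forced
set_option linter.dupNamespace false

open CategoryTheory CategoryTheory.Limits AlgebraicGeometry Literature.AlgebraicGeometry.Resolution
open Summit.ResolutionOfSingularities.ResolutionOfSingularities.Theses.SectionAscent (AffineToGlobal)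

namespace Summit.ResolutionOfSingularities.ResolutionOfSingularities.Cruxes.AffineToGlobal.Lines.Birth

/-! ## The predicates of the cut -/

/-- **Affine one-shot in characteristic `p`, all dimensions** — verbatim `∀ d, OneShot p d` for
the `let`-bound `OneShot` of the route file (`SectionAscent.AffineToGlobal`).
[cite: CossartPiltant2019, Thm. 1.1 and p. 3] -/
def AffineOneShot (p : ℕ) : Prop :=
  ∀ d : ℕ, ∀ (K : Type) [Field K] [CharP K p] (A : Type) [CommRing A] [IsDomain A] [Algebra K A]
    [Algebra.FiniteType K A], ringKrullDim A < (d : WithBot ℕ∞) → ∃ I : Ideal A, I ≠ ⊥ ∧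
      Literature.AlgebraicGeometry.Resolution.Scheme.IsRegular
        (Literature.AlgebraicGeometry.Resolution.affineBlowup I) ∧
      ∀ 𝔭 : PrimeSpectrum A, I ≤ 𝔭.asIdeal ↔ ¬ IsRegularLocalRing (Localization.AtPrime 𝔭.asIdeal)

/-- **Temkin's local condition at a singular point** (Prop. 2.3.4 (iii), variant (1), over a
field of characteristic `p`, as consumed by the landed
`ModificationPatching.resolutionInChar_of_localDesingularization`): for the integral `X` of
finite type over `K`, the point `x ∉ Reg X`, every blow-up `g : S' → Spec 𝒪_{X,x}` whose
non-regular points lie over the closed point admits a desingularization.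
[cite: Temkin2008, Prop. 2.3.4 (iii)] -/
def LocalCondition (K : Type) [Field K] (X : Scheme.{0}) (x : X) : Prop :=
  x ∉ Scheme.regularLocus X → ∀ (S' : Scheme.{0}) (g : S' ⟶ Spec (X.presheaf.stalk x))
    (I : (Spec (X.presheaf.stalk x)).IdealSheafData), IsBlowup g I →
    (∀ s : S', s ∉ Scheme.regularLocus S' → g s = IsLocalRing.closedPoint (X.presheaf.stalk x)) →
    Scheme.AdmitsDesingularization S'

/-! ## The stub STATEMENTS by name (`Sig.stub_<name>`), self-contained -/

/-- Statement of `stub_finiteSingularLocus`: under `AffineOneShot p`, a blow-up of a local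
scheme `Spec 𝒪_{X,x}` of an integral variety with FINITELY many non-regular points admits a
desingularization. [cite: Temkin2008, §2.1 and Prop. 2.3.4 (proof)] -/
def Sig.stub_finiteSingularLocus : Prop :=
  ∀ p : ℕ, p.Prime →
    (∀ d : ℕ, ∀ (K : Type) [Field K] [CharP K p] (A : Type) [CommRing A] [IsDomain A]
      [Algebra K A] [Algebra.FiniteType K A], ringKrullDim A < (d : WithBot ℕ∞) →
      ∃ I : Ideal A, I ≠ ⊥ ∧
        Literature.AlgebraicGeometry.Resolution.Scheme.IsRegular
          (Literature.AlgebraicGeometry.Resolution.affineBlowup I) ∧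
        ∀ 𝔭 : PrimeSpectrum A, I ≤ 𝔭.asIdeal ↔
          ¬ IsRegularLocalRing (Localization.AtPrime 𝔭.asIdeal)) →
    ∀ (K : Type) [Field K] [CharP K p] (X : Scheme.{0}) [IsIntegral X] (f : X ⟶ Spec (.of K))
      [LocallyOfFiniteType f] [QuasiCompact f] (x : X) (S' : Scheme.{0})
      (g : S' ⟶ Spec (X.presheaf.stalk x)) (I : (Spec (X.presheaf.stalk x)).IdealSheafData),
      IsBlowup g I → (Scheme.regularLocus S')ᶜ.Finite → Scheme.AdmitsDesingularization S'

/-- Statement of `stub_infiniteSingularLocus`: under `AffineOneShot p`, Temkin's local condition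
at a singular point `x` of an integral variety for blow-ups `S'` of `Spec 𝒪_{X,x}` with
INFINITELY many non-regular points (all over the closed point), given the local condition at
every point of strictly smaller local dimension of every integral variety over every field of
characteristic `p`. [cite: Temkin2008, Prop. 2.3.4; CossartPiltant2019, p. 3] -/
def Sig.stub_infiniteSingularLocus : Prop :=
  ∀ p : ℕ, p.Prime →
    (∀ d : ℕ, ∀ (K : Type) [Field K] [CharP K p] (A : Type) [CommRing A] [IsDomain A]
      [Algebra K A] [Algebra.FiniteType K A], ringKrullDim A < (d : WithBot ℕ∞) →
      ∃ I : Ideal A, I ≠ ⊥ ∧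
        Literature.AlgebraicGeometry.Resolution.Scheme.IsRegular
          (Literature.AlgebraicGeometry.Resolution.affineBlowup I) ∧
        ∀ 𝔭 : PrimeSpectrum A, I ≤ 𝔭.asIdeal ↔
          ¬ IsRegularLocalRing (Localization.AtPrime 𝔭.asIdeal)) →
    ∀ (K : Type) [Field K] [CharP K p] (X : Scheme.{0}) [IsIntegral X] (f : X ⟶ Spec (.of K))
      [LocallyOfFiniteType f] [QuasiCompact f] (x : X), x ∉ Scheme.regularLocus X →
      ∀ (S' : Scheme.{0}) (g : S' ⟶ Spec (X.presheaf.stalk x))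
        (I : (Spec (X.presheaf.stalk x)).IdealSheafData), IsBlowup g I →
        (∀ s : S', s ∉ Scheme.regularLocus S' →
          g s = IsLocalRing.closedPoint (X.presheaf.stalk x)) →
        (Scheme.regularLocus S')ᶜ.Infinite →
        (∀ (K' : Type) [Field K'] [CharP K' p] (X' : Scheme.{0}) [IsIntegral X']
          (f' : X' ⟶ Spec (.of K')) [LocallyOfFiniteType f'] [QuasiCompact f'] (x' : X'),
          ringKrullDim (X'.presheaf.stalk x') < ringKrullDim (X.presheaf.stalk x) →
          x' ∉ Scheme.regularLocus X' →
          ∀ (S'' : Scheme.{0}) (g' : S'' ⟶ Spec (X'.presheaf.stalk x'))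
            (I' : (Spec (X'.presheaf.stalk x')).IdealSheafData), IsBlowup g' I' →
            (∀ s : S'', s ∉ Scheme.regularLocus S'' →
              g' s = IsLocalRing.closedPoint (X'.presheaf.stalk x')) →
            Scheme.AdmitsDesingularization S'') →
        Scheme.AdmitsDesingularization S'

/-! ## The stubs (registered signatures) -/

/-- **STUB `stub_finiteSingularLocus` — LANDED (p154487,
`Theorems/SectionAscentAffineToGlobalAffineSingularLocus.lean`,
`Theorems.AffineToGlobal.AffineSingularLocus.stub_finiteSingularLocus`).** Under affine
`Sing`-exact one-shots in characteristic `p`, a blow-up `S'` of `Spec 𝒪_{X,x}` (`X` integral of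
finite type over a field of characteristic `p`) with finitely many non-regular points admits a
desingularization. [cite: Temkin2008, §2.1 and Prop. 2.3.4 (proof)] -/
theorem stub_finiteSingularLocus (p : ℕ) (hp : p.Prime)
    (h : ∀ d : ℕ, ∀ (K : Type) [Field K] [CharP K p] (A : Type) [CommRing A] [IsDomain A]
      [Algebra K A] [Algebra.FiniteType K A], ringKrullDim A < (d : WithBot ℕ∞) →
      ∃ I : Ideal A, I ≠ ⊥ ∧
        Literature.AlgebraicGeometry.Resolution.Scheme.IsRegular
          (Literature.AlgebraicGeometry.Resolution.affineBlowup I) ∧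
        ∀ 𝔭 : PrimeSpectrum A, I ≤ 𝔭.asIdeal ↔
          ¬ IsRegularLocalRing (Localization.AtPrime 𝔭.asIdeal))
    (K : Type) [Field K] [CharP K p] (X : Scheme.{0}) [IsIntegral X] (f : X ⟶ Spec (.of K))
    [LocallyOfFiniteType f] [QuasiCompact f] (x : X) (S' : Scheme.{0})
    (g : S' ⟶ Spec (X.presheaf.stalk x)) (I : (Spec (X.presheaf.stalk x)).IdealSheafData)
    (hg : IsBlowup g I) (hfin : (Scheme.regularLocus S')ᶜ.Finite) :
    Scheme.AdmitsDesingularization S' :=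
  -- LANDED (p154487)
  Theorems.AffineToGlobal.AffineSingularLocus.stub_finiteSingularLocus p hp h K X f x S' g I hg hfin

/-- **STUB `stub_infiniteSingularLocus` (OPEN — the crux's residue).** Under affine `Sing`-exact
one-shots in characteristic `p`: Temkin's local condition at a singular point `x` of an integral
variety `X` over a field of characteristic `p`, for blow-ups `S'` of `Spec 𝒪_{X,x}` with
INFINITELY many non-regular points, all over the closed point — given the same local condition
at every point of strictly smaller local dimension of every integral variety over every field of
characteristic `p` (induction hypothesis). The honest open content: positive-dimensional
singular loci in closed fibres of modifications of a local ring, at EQUAL local dimension along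
a tower of closed points (see the module docstring and `KERNEL.md`).
[cite: Temkin2008, Prop. 2.3.4; CossartPiltant2019, p. 3] -/
theorem stub_infiniteSingularLocus (p : ℕ) (hp : p.Prime)
    (h : ∀ d : ℕ, ∀ (K : Type) [Field K] [CharP K p] (A : Type) [CommRing A] [IsDomain A]
      [Algebra K A] [Algebra.FiniteType K A], ringKrullDim A < (d : WithBot ℕ∞) →
      ∃ I : Ideal A, I ≠ ⊥ ∧
        Literature.AlgebraicGeometry.Resolution.Scheme.IsRegular
          (Literature.AlgebraicGeometry.Resolution.affineBlowup I) ∧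
        ∀ 𝔭 : PrimeSpectrum A, I ≤ 𝔭.asIdeal ↔
          ¬ IsRegularLocalRing (Localization.AtPrime 𝔭.asIdeal))
    (K : Type) [Field K] [CharP K p] (X : Scheme.{0}) [IsIntegral X] (f : X ⟶ Spec (.of K))
    [LocallyOfFiniteType f] [QuasiCompact f] (x : X) (hx : x ∉ Scheme.regularLocus X)
    (S' : Scheme.{0}) (g : S' ⟶ Spec (X.presheaf.stalk x))
    (I : (Spec (X.presheaf.stalk x)).IdealSheafData) (hg : IsBlowup g I)
    (hs : ∀ s : S', s ∉ Scheme.regularLocus S' →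
      g s = IsLocalRing.closedPoint (X.presheaf.stalk x))
    (hinf : (Scheme.regularLocus S')ᶜ.Infinite)
    (ih : ∀ (K' : Type) [Field K'] [CharP K' p] (X' : Scheme.{0}) [IsIntegral X']
      (f' : X' ⟶ Spec (.of K')) [LocallyOfFiniteType f'] [QuasiCompact f'] (x' : X'),
      ringKrullDim (X'.presheaf.stalk x') < ringKrullDim (X.presheaf.stalk x) →
      x' ∉ Scheme.regularLocus X' →
      ∀ (S'' : Scheme.{0}) (g' : S'' ⟶ Spec (X'.presheaf.stalk x'))
        (I' : (Spec (X'.presheaf.stalk x')).IdealSheafData), IsBlowup g' I' →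
        (∀ s : S'', s ∉ Scheme.regularLocus S'' →
          g' s = IsLocalRing.closedPoint (X'.presheaf.stalk x')) →
        Scheme.AdmitsDesingularization S'') :
    Scheme.AdmitsDesingularization S' := by
  sorry

/-! ## The composition (kernel-checked; no `sorry` in its own term) -/

/-- **Temkin's local condition from the two stubs**, by well-founded induction on the local
dimension `dim 𝒪_{X,x} ∈ WithBot ℕ∞`: at a singular point, a blow-up of `Spec 𝒪_{X,x}` has either
finitely many non-regular points (`stub_finiteSingularLocus`) or infinitely many
(`stub_infiniteSingularLocus`, fed with the induction hypothesis). [cite: Temkin2008, Prop. 2.3.4] -/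
theorem localCondition_of_kernel (h₁ : Sig.stub_finiteSingularLocus)
    (h₂ : Sig.stub_infiniteSingularLocus) (p : ℕ) (hp : p.Prime) (hOne : AffineOneShot p)
    (K : Type) [Field K] [CharP K p] (X : Scheme.{0}) [IsIntegral X] (f : X ⟶ Spec (.of K))
    [LocallyOfFiniteType f] [QuasiCompact f] (x : X) : LocalCondition K X x := by
  suffices H : ∀ (d : WithBot ℕ∞) (K : Type) [Field K] [CharP K p] (X : Scheme.{0})
      [IsIntegral X] (f : X ⟶ Spec (.of K)) [LocallyOfFiniteType f] [QuasiCompact f] (x : X),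
      ringKrullDim (X.presheaf.stalk x) = d → LocalCondition K X x from
    H _ K X f x rfl
  intro d
  induction d using WellFoundedLT.induction with
  | ind d ih =>
    intro K _ _ X _ f _ _ x hd hx S' g I hg hs
    by_cases hfin : (Scheme.regularLocus S')ᶜ.Finite
    · exact h₁ p hp hOne K X f x S' g I hg hfin
    · exact h₂ p hp hOne K X f x hx S' g I hg hs hfin
        fun K' _ _ X' _ f' _ _ x' hlt hx' S'' g' I' hg' hs' =>
          ih _ (hd ▸ hlt) K' X' f' x' rfl hx' S'' g' I' hg' hs'

/-- `Sig.stub_finiteSingularLocus` HOLDS: it is the landed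
`Theorems.AffineToGlobal.AffineSingularLocus.stub_finiteSingularLocus` (p154487). -/
theorem sig_stub_finiteSingularLocus_holds : Sig.stub_finiteSingularLocus :=
  fun p hp h K _ _ X _ f _ _ x S' g I hg hfin =>
    Theorems.AffineToGlobal.AffineSingularLocus.stub_finiteSingularLocus p hp h K X f x S' g I hg hfin

/-- **`AffineToGlobal` from the ONE open stub statement** (the skeleton theorem of reshape 2,
PROVED; first theorem of the file concluding the crux): Temkin's local condition from
`stub_infiniteSingularLocus` and the landed finite case (`localCondition_of_kernel`), then the
landed `ModificationPatching.resolutionInChar_of_localDesingularization`.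
[cite: Temkin2008, Prop. 2.3.4; CossartPiltant2019, Prop. 4.6 (proof, Steps 1–3)] -/
theorem AffineToGlobal_of_infiniteSingularLocus : Sig.stub_infiniteSingularLocus → AffineToGlobal :=
  fun h₂ p hp hOne =>
    Theorems.AffineToGlobal.ModificationPatching.resolutionInChar_of_localDesingularization p
      fun K _ _ X _ f _ _ x =>
        localCondition_of_kernel sig_stub_finiteSingularLocus_holds h₂ p hp hOne K X f x

/-- **`ResolutionInChar p` from the two stub statements, prime by prime** (the reshaped assembly
with both cut pieces as hypotheses, PROVED; stated on `ResolutionInChar p` so that the skeleton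
theorem concluding the crux by name is the one-hypothesis `AffineToGlobal_of_infiniteSingularLocus`).
[cite: Temkin2008, Prop. 2.3.4; CossartPiltant2019, Prop. 4.6 (proof, Steps 1–3)] -/
theorem resolutionInChar_of_kernel (h₁ : Sig.stub_finiteSingularLocus)
    (h₂ : Sig.stub_infiniteSingularLocus) (p : ℕ) (hp : p.Prime) (hOne : AffineOneShot p) :
    ResolutionInChar.{0} p :=
  Theorems.AffineToGlobal.ModificationPatching.resolutionInChar_of_localDesingularization p
    fun K _ _ X _ f _ _ x => localCondition_of_kernel h₁ h₂ p hp hOne K X f x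

/-- **The crux `AffineToGlobal`, assembled from the registered stubs of the Temkin cut** (the
skeleton in the shape of reshape 2: `stub_finiteSingularLocus` landed (p154487) and imported, the
only `sorry` in the closure is `stub_infiniteSingularLocus`). -/
theorem AffineToGlobal_proof : AffineToGlobal :=
  AffineToGlobal_of_infiniteSingularLocus stub_infiniteSingularLocus

/-! ## The weak-frame cut (reshape 3): regular blow-ups of projective varieties

`Scheme.HasResolution` is the WEAK statement (proper birational regular model, no condition over
`Reg`), so `ResolutionInChar p` follows from: every integral closed `X ⊆ ℙⁿ_K` has a blow-up along
a non-zero ideal sheaf whose source is regular. Under the crux's hypothesis this holds as soon as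
some blow-up of `X` has finitely many non-regular points. Stub STATEMENTS by name first
(`Sig.stub_<name>`, self-contained), then the registered stubs, then the composition. -/

/-- Statement of `stub_regularBlowupSuffices`: for any `p`, if every integral closed
subscheme of every `ℙⁿ_K` over every field `K` of characteristic `p` admits a blow-up along a
non-zero ideal sheaf with regular source, then `ResolutionInChar p`.
[cite: Kollar2007, Thm. 3.36 (weak form); StacksProject, Tag 02ND] -/
def Sig.stub_regularBlowupSuffices : Prop :=
  ∀ p : ℕ,
    (∀ (K : Type) [Field K] [CharP K p] (n : ℕ) (X : Scheme.{0})
      (ι : X ⟶ (Literature.AlgebraicGeometry.Motives.projectiveSpace n K).left),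
      IsClosedImmersion ι → IsIntegral X →
      ∃ (X' : Scheme.{0}) (π : X' ⟶ X) (J : X.IdealSheafData),
        J ≠ ⊥ ∧ IsBlowup π J ∧ Scheme.IsRegular X') →
    ResolutionInChar.{0} p

/-- Statement of `stub_isolatedSingularitiesSuffice`: under `AffineOneShot p`, an integral closed
`X ⊆ ℙⁿ_K` some blow-up of which (along a non-zero ideal sheaf) has finitely many non-regular
points admits a blow-up along a non-zero ideal sheaf with regular source.
[cite: MumfordAV1970, §7, Remark p. 69; StacksProject, Tag 080B] -/
def Sig.stub_isolatedSingularitiesSuffice : Prop :=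
  ∀ p : ℕ,
    (∀ d : ℕ, ∀ (K : Type) [Field K] [CharP K p] (A : Type) [CommRing A] [IsDomain A]
      [Algebra K A] [Algebra.FiniteType K A], ringKrullDim A < (d : WithBot ℕ∞) →
      ∃ I : Ideal A, I ≠ ⊥ ∧
        Literature.AlgebraicGeometry.Resolution.Scheme.IsRegular
          (Literature.AlgebraicGeometry.Resolution.affineBlowup I) ∧
        ∀ 𝔭 : PrimeSpectrum A, I ≤ 𝔭.asIdeal ↔
          ¬ IsRegularLocalRing (Localization.AtPrime 𝔭.asIdeal)) →
    ∀ (K : Type) [Field K] [CharP K p] (n : ℕ) (X : Scheme.{0})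
      (ι : X ⟶ (Literature.AlgebraicGeometry.Motives.projectiveSpace n K).left),
      IsClosedImmersion ι → IsIntegral X →
      ∀ (X₁ : Scheme.{0}) (π₁ : X₁ ⟶ X) (J₁ : X.IdealSheafData), J₁ ≠ ⊥ → IsBlowup π₁ J₁ →
        (Scheme.regularLocus X₁)ᶜ.Finite →
        ∃ (X' : Scheme.{0}) (π : X' ⟶ X) (J : X.IdealSheafData),
          J ≠ ⊥ ∧ IsBlowup π J ∧ Scheme.IsRegular X'

/-- Statement of `stub_isolatingBlowup`: under `AffineOneShot p`, every integral closed
`X ⊆ ℙⁿ_K` over a field of characteristic `p` has a blow-up along a non-zero ideal sheaf whose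
source has finitely many non-regular points. [cite: CossartPiltant2019, Thm. 1.1 and p. 3] -/
def Sig.stub_isolatingBlowup : Prop :=
  ∀ p : ℕ, p.Prime →
    (∀ d : ℕ, ∀ (K : Type) [Field K] [CharP K p] (A : Type) [CommRing A] [IsDomain A]
      [Algebra K A] [Algebra.FiniteType K A], ringKrullDim A < (d : WithBot ℕ∞) →
      ∃ I : Ideal A, I ≠ ⊥ ∧
        Literature.AlgebraicGeometry.Resolution.Scheme.IsRegular
          (Literature.AlgebraicGeometry.Resolution.affineBlowup I) ∧
        ∀ 𝔭 : PrimeSpectrum A, I ≤ 𝔭.asIdeal ↔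
          ¬ IsRegularLocalRing (Localization.AtPrime 𝔭.asIdeal)) →
    ∀ (K : Type) [Field K] [CharP K p] (n : ℕ) (X : Scheme.{0})
      (ι : X ⟶ (Literature.AlgebraicGeometry.Motives.projectiveSpace n K).left),
      IsClosedImmersion ι → IsIntegral X →
      ∃ (X₁ : Scheme.{0}) (π₁ : X₁ ⟶ X) (J₁ : X.IdealSheafData),
        J₁ ≠ ⊥ ∧ IsBlowup π₁ J₁ ∧ (Scheme.regularLocus X₁)ᶜ.Finite

/-- **STUB `stub_regularBlowupSuffices` — LANDED (p157245, `Theorems/SectionAscentAffineToGlobalRegularBlowupSuffices.lean`, `Theorems.AffineToGlobal.RegularBlowupSuffices.stub_regularBlowupSuffices`).** If every integral closed subscheme of every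
`ℙⁿ_K`, `char K = p`, admits a blow-up along a non-zero ideal sheaf with regular source, then
`ResolutionInChar p`: such a blow-up is proper and birational (`IsBlowup.isResolution'` with
`stacks02NS_holds`; `X` is locally Noetherian, being of finite type over `K` through
`ℙⁿ_K → Spec K`), hence a resolution in the weak sense, and the projective integral case suffices
(`Theorems.WeightedThesis.ProjectiveIntegralSuffices.stub_projectiveIntegralSuffices`).
[cite: Kollar2007, Thm. 3.36 (weak form); StacksProject, Tag 02ND] -/
theorem stub_regularBlowupSuffices (p : ℕ)
    (h : ∀ (K : Type) [Field K] [CharP K p] (n : ℕ) (X : Scheme.{0})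
      (ι : X ⟶ (Literature.AlgebraicGeometry.Motives.projectiveSpace n K).left),
      IsClosedImmersion ι → IsIntegral X →
      ∃ (X' : Scheme.{0}) (π : X' ⟶ X) (J : X.IdealSheafData),
        J ≠ ⊥ ∧ IsBlowup π J ∧ Scheme.IsRegular X') :
    ResolutionInChar.{0} p :=
  -- LANDED (p157245)
  Theorems.AffineToGlobal.RegularBlowupSuffices.stub_regularBlowupSuffices p h

/-- **STUB `stub_isolatedSingularitiesSuffice` — LANDED (p157563, `Theorems/SectionAscentAffineToGlobalIsolatedSingularitiesSuffice.lean`, `Theorems.AffineToGlobal.IsolatedSingularitiesSuffice.stub_isolatedSingularitiesSuffice`) — isolated singularities suffice.**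
Assume affine `Sing`-exact one-shots in characteristic `p` in all dimensions. Let `X ⊆ ℙⁿ_K` be
integral and closed (`char K = p`) and `π₁ : X₁ → X` a blow-up along `J₁ ≠ 0` whose source has
finitely many non-regular points. Then some blow-up of `X` along a non-zero ideal sheaf is
regular. Proof: `X₁` is integral (`IsBlowup.isIntegral`) and of finite type over `K` (`π₁` is
proper, `ℙⁿ_K → Spec K` is proper); the images in `X` of the finitely many non-regular points lie
in one basic affine open `U = X ∩ D₊(F)` (`GradedPrimeAvoidance.exists_form_basicOpen` for the
closed immersion `ι`, `Proj.isAffineOpen_basicOpen`, affineness is inherited along the closed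
immersion); `π₁` restricted over `U` is a blow-up of the affine `U` (`IsBlowup.restrict`), so the
points lie in one affine open `Ω ⊆ π₁⁻¹U ⊆ X₁` (`exists_isAffineOpen_forall_mem_of_isBlowup`,
image of an affine open under the open immersion `(π₁⁻¹U).ι`); the landed
`AffineSingularLocus.exists_oneShotSheaf_of_compl_regularLocus_subset` gives `J' ≠ 0` on `X₁` all
of whose blow-ups are regular; blow up (`exists_isBlowup`), and compose: `X' → X₁ → X` is a
blow-up of the Noetherian `X` along some `Q` (`IsBlowup.exists_isBlowup_comp`), and `Q ≠ 0`
because `X'` is non-empty (`IsBlowup.isEmpty_of_bot`; `X'` is integral as a blow-up of the integral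
`X₁` along `J' ≠ 0`). [cite: MumfordAV1970, §7, Remark p. 69; StacksProject, Tag 080B] -/
theorem stub_isolatedSingularitiesSuffice (p : ℕ)
    (h : ∀ d : ℕ, ∀ (K : Type) [Field K] [CharP K p] (A : Type) [CommRing A] [IsDomain A]
      [Algebra K A] [Algebra.FiniteType K A], ringKrullDim A < (d : WithBot ℕ∞) →
      ∃ I : Ideal A, I ≠ ⊥ ∧
        Literature.AlgebraicGeometry.Resolution.Scheme.IsRegular
          (Literature.AlgebraicGeometry.Resolution.affineBlowup I) ∧
        ∀ 𝔭 : PrimeSpectrum A, I ≤ 𝔭.asIdeal ↔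
          ¬ IsRegularLocalRing (Localization.AtPrime 𝔭.asIdeal))
    (K : Type) [Field K] [CharP K p] (n : ℕ) (X : Scheme.{0})
    (ι : X ⟶ (Literature.AlgebraicGeometry.Motives.projectiveSpace n K).left)
    (hι : IsClosedImmersion ι) (hX : IsIntegral X) (X₁ : Scheme.{0}) (π₁ : X₁ ⟶ X)
    (J₁ : X.IdealSheafData) (hJ₁ : J₁ ≠ ⊥) (hπ₁ : IsBlowup π₁ J₁)
    (hfin : (Scheme.regularLocus X₁)ᶜ.Finite) :
    ∃ (X' : Scheme.{0}) (π : X' ⟶ X) (J : X.IdealSheafData),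
      J ≠ ⊥ ∧ IsBlowup π J ∧ Scheme.IsRegular X' :=
  -- LANDED (p157563)
  Theorems.AffineToGlobal.IsolatedSingularitiesSuffice.stub_isolatedSingularitiesSuffice p h K n X ι hι hX
    X₁ π₁ J₁ hJ₁ hπ₁ hfin

/-- **STUB `stub_isolatingBlowup` (OPEN — the weak-frame residue of the crux).** Under affine
`Sing`-exact one-shots in characteristic `p` in all dimensions: every integral closed `X ⊆ ℙⁿ_K`
over a field `K` of characteristic `p` admits a blow-up along a non-zero ideal sheaf whose source
has only finitely many non-regular points ("the singularities of a projective variety can be made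
isolated by one blow-up"). In dimension `≤ 3` the weak summit itself is known over every field
(Cossart–Piltant 2019, Thm. 1.1, `π` projective over the members of a specified finite affine
cover), and a regular projective model (a regular blow-up, Liu 2002, Thm. 8.1.24) over fields
differentially finite over a perfect field (Cossart–Piltant 2008/09); open from dimension 4, of
the same kind as the summit; the hypothesis is used by the line only downstream of it
(`stub_isolatedSingularitiesSuffice`). See `KERNEL-2.md`.
[cite: CossartPiltant2019, Thm. 1.1 and p. 3; Liu2002, Thm. 8.1.24] -/
theorem stub_isolatingBlowup (p : ℕ) (hp : p.Prime)
    (h : ∀ d : ℕ, ∀ (K : Type) [Field K] [CharP K p] (A : Type) [CommRing A] [IsDomain A]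
      [Algebra K A] [Algebra.FiniteType K A], ringKrullDim A < (d : WithBot ℕ∞) →
      ∃ I : Ideal A, I ≠ ⊥ ∧
        Literature.AlgebraicGeometry.Resolution.Scheme.IsRegular
          (Literature.AlgebraicGeometry.Resolution.affineBlowup I) ∧
        ∀ 𝔭 : PrimeSpectrum A, I ≤ 𝔭.asIdeal ↔
          ¬ IsRegularLocalRing (Localization.AtPrime 𝔭.asIdeal))
    (K : Type) [Field K] [CharP K p] (n : ℕ) (X : Scheme.{0})
    (ι : X ⟶ (Literature.AlgebraicGeometry.Motives.projectiveSpace n K).left)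
    (hι : IsClosedImmersion ι) (hX : IsIntegral X) :
    ∃ (X₁ : Scheme.{0}) (π₁ : X₁ ⟶ X) (J₁ : X.IdealSheafData),
      J₁ ≠ ⊥ ∧ IsBlowup π₁ J₁ ∧ (Scheme.regularLocus X₁)ᶜ.Finite := by
  sorry

/-- **`AffineToGlobal` from the weak-frame stubs** (kernel-checked composition of reshape 3):
isolate the singularities by one blow-up (`stub_isolatingBlowup`), resolve the isolated
singularities by a second blow-up and compose (`stub_isolatedSingularitiesSuffice`), and conclude
by `stub_regularBlowupSuffices`. [cite: CossartPiltant2019, p. 3; Kollar2007, Thm. 3.36] -/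
theorem AffineToGlobal_of_weakFrame (h₁ : Sig.stub_isolatingBlowup)
    (h₂ : Sig.stub_isolatedSingularitiesSuffice) (h₃ : Sig.stub_regularBlowupSuffices) :
    AffineToGlobal := by
  intro p hp hOne
  refine h₃ p fun K _ _ n X ι hι hX => ?_
  obtain ⟨X₁, π₁, J₁, hJ₁, hπ₁, hfin⟩ := h₁ p hp hOne K n X ι hι hX
  exact h₂ p hOne K n X ι hι hX X₁ π₁ J₁ hJ₁ hπ₁ hfin

/-- **`AffineToGlobal` from the ONE open stub of the weak-frame cut**, the two true stubs being
fed in as the registered theorems of this file (both LANDED, p157245 and p157563, so the only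
`sorry` in this closure is `stub_isolatingBlowup`). -/
theorem AffineToGlobal_of_isolatingBlowup (h₁ : Sig.stub_isolatingBlowup) : AffineToGlobal :=
  AffineToGlobal_of_weakFrame h₁
    (fun p h K _ _ n X ι hι hX X₁ π₁ J₁ hJ₁ hπ₁ hfin =>
      stub_isolatedSingularitiesSuffice p h K n X ι hι hX X₁ π₁ J₁ hJ₁ hπ₁ hfin)
    (fun p h => stub_regularBlowupSuffices p h)

/-- **The crux `AffineToGlobal`, assembled from the registered stubs of the weak-frame cut.** -/
theorem AffineToGlobal_proof' : AffineToGlobal :=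
  AffineToGlobal_of_isolatingBlowup fun p hp h K _ _ n X ι hι hX =>
    stub_isolatingBlowup p hp h K n X ι hι hX

end Summit.ResolutionOfSingularities.ResolutionOfSingularities.Cruxes.AffineToGlobal.Lines.Birth

end
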